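import Summits.QuantumFields.YangMills.Theorems.FradkinShenkerFlowFiniteSusceptibilityWeakCouplingOddSectorRate
import Summits.QuantumFields.YangMills.Theorems.FradkinShenkerFlowFiniteSusceptibilityWeakCouplingAxisIsotropy
import HarnessLib

/-!
# Spatial lattice Vafa–Witten: β-uniform axial `ℓ¹` bound for axis-reflection-odd species (item stmt-QuantumFields-9442)

Support file for item stmt-QuantumFields-9442 (route `FradkinShenkerFlow` of `YangMills`), crux
`Summit.QuantumFields.YangMills.Theses.FradkinShenkerFlow.FiniteSusceptibilityWeakCoupling`, line `purity-rate-split`,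
stub `stub_axisOddSpeciesSummable`.

**What is proved.** Let `θ_k V := configPermZd (swap 0 k) (cfgReflect (configPermZd (swap 0 k) V))` be the reflection
`x_k ↦ −x_k` of a `ℤ⁴` lattice gauge field (the time reflection `Θ = cfgReflect` conjugated by the axis swap `0 ↔ k`).
For every compact `G`, every lattice representation `r`, every axis `k : Fin 4` and every `θ_k`-ODD gauge-invariant local
observable `A` (`A ∘ θ_k = −A`) there is `C` such that for ALL `β ≥ 0` and all odd tori `2S+1`,
`Σ_{n<2S+1} |Cov_{β,S}(A∘lift, A∘τ_{n e_k}∘lift)| ≤ C`.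

**Mechanism.** With `π = swap 0 k`, the permuted species `A^π = A ∘ configPermZd π` (`AxisIsotropy.permSpecies`) is
time-reflection-odd (`configPermZd π` is an involution, `AxisOddSummable.configPermZd_swap_configPermZd_swap`), so the
landed time-axis bound `OddSectorRate.oddSpecies_sum_abs_autocorr_le_uniform` applies to it; term by term the axis-`k`
covariance of `A` is the time-axis connected correlator of `A^π` (`AxisIsotropy.covariance_perm`,
`SiblingFunnel.covariance_eq_latticeConnectedCorr`, `sitePermZd π (n e₀) = n e_k`). Reflection positivity, translation
invariance and boundedness only; nothing here is a named fact. [folklore]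
-/

noncomputable section

open MeasureTheory ProbabilityTheory Finset
open Literature.MathematicalPhysics.QuantumFieldTheory hiding Site ZdEdge
open Literature.MathematicalPhysics.QuantumLattice
open Literature.Probability.LatticeModels hiding configShift configShift_apply

namespace Summit.QuantumFields.YangMills.Theorems.FiniteSusceptibilityWeakCoupling

namespace AxisOddSummable

open AxisIsotropy

/-- `sitePermZd (swap i k)` is an involution of `ℤ^d`. [folklore] -/
theorem sitePermZd_swap_sitePermZd_swap {d : ℕ} (i k : Fin d) (x : Literature.Probability.LatticeModels.Site d) :
    sitePermZd (Equiv.swap i k) (sitePermZd (Equiv.swap i k) x) = x := by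
  funext j
  simp only [sitePermZd_apply, Equiv.symm_swap, Equiv.swap_apply_self]

variable {G : Type} [MeasurableSpace G]

/-- `configPermZd (swap i k)` is an involution of the `ℤ^d` gauge fields. [folklore] -/
theorem configPermZd_swap_configPermZd_swap {d : ℕ} (i k : Fin d) (V : LGConfig d G) :
    configPermZd (Equiv.swap i k) (configPermZd (Equiv.swap i k) V) = V := by
  funext e
  simp only [configPermZd_apply, Equiv.symm_swap, sitePermZd_swap_sitePermZd_swap, Equiv.swap_apply_self]

variable [Group G]

/-- **A `θ_k`-odd species permutes to a time-reflection-odd one**: if `A ∘ θ_k = −A` with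
`θ_k = configPermZd π ∘ cfgReflect ∘ configPermZd π`, `π = swap 0 k`, then `A^π ∘ Θ = −A^π`. [folklore] -/
theorem permSpecies_odd (k : Fin 4) (A : YMSpecies G)
    (hodd : ∀ V, A.F (configPermZd (Equiv.swap 0 k) (cfgReflect (configPermZd (Equiv.swap 0 k) V))) = -A.F V)
    (V : LGConfig 4 G) :
    (permSpecies (Equiv.swap 0 k) A).F (cfgReflect V) = -(permSpecies (Equiv.swap 0 k) A).F V := by
  have h := hodd (configPermZd (Equiv.swap 0 k) V)
  rw [configPermZd_swap_configPermZd_swap] at h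
  simpa only [permSpecies_F] using h

variable [TopologicalSpace G] [IsTopologicalGroup G] [CompactSpace G] [BorelSpace G]

/-- **Term-by-term transport**: the axis-`k` covariance of `A` at lag `n` on the torus `2S+1` is the time-axis connected
correlator of the permuted species `A^π`, `π = swap 0 k` (every compact `G`, every `β`). [folklore] -/
theorem covariance_axis_eq_latticeConnectedCorr_perm (r : LatticeRep G) (β : ℝ) (k : Fin 4) (A : YMSpecies G)
    (S n : ℕ) :
    cov[fun U => A.F (torusLift (2 * S + 1) U),
        fun U => A.F (configShift (-(Pi.single k (n : ℤ))) (torusLift (2 * S + 1) U));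
        wilsonMeasure (d := 4) (L := 2 * S + 1) r.ρ β] =
      latticeConnectedCorr r.ρ β (2 * S + 1) (permSpecies (Equiv.swap 0 k) A).F
        (permSpecies (Equiv.swap 0 k) A).F n := by
  have key := covariance_perm r β (Equiv.swap 0 k) A A S (-(Pi.single 0 (n : ℤ)))
  rw [sitePermZd_neg, sitePermZd_single, Equiv.swap_apply_left] at key
  rw [key, SiblingFunnel.covariance_eq_latticeConnectedCorr]

/-- **Spatial lattice Vafa–Witten, β-uniform `ℓ¹` form** (every compact `G`, every lattice representation, every axis
`k`): a `θ_k`-odd species has `Σ_{n<2S+1} |Cov_{β,S}(A∘lift, A∘τ_{n e_k}∘lift)| ≤ C` for ALL `β ≥ 0` and all `S`, with `C`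
depending on `A` only. [folklore] -/
theorem axisOddSpecies_sum_abs_cov_le_uniform (r : LatticeRep G) (k : Fin 4) (A : YMSpecies G)
    (hodd : ∀ V, A.F (configPermZd (Equiv.swap 0 k) (cfgReflect (configPermZd (Equiv.swap 0 k) V))) = -A.F V) :
    ∃ C : ℝ, ∀ β : ℝ, 0 ≤ β → ∀ S : ℕ,
      ∑ n ∈ range (2 * S + 1), |cov[fun U => A.F (torusLift (2 * S + 1) U),
          fun U => A.F (configShift (-(Pi.single k (n : ℤ))) (torusLift (2 * S + 1) U));
          wilsonMeasure (d := 4) (L := 2 * S + 1) r.ρ β]| ≤ C := by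
  -- the time extent `R` of the permuted species
  obtain ⟨R, hR3⟩ : ∃ R : ℕ, ∀ e ∈ (permSpecies (Equiv.swap 0 k) A).supp, (e.1 0).natAbs + 3 ≤ R := by
    refine ⟨((permSpecies (Equiv.swap 0 k) A).supp.sup fun e => (e.1 0).natAbs) + 3, fun e he => ?_⟩
    have := Finset.le_sup (f := fun e : ZdEdge 4 => (e.1 0).natAbs) he
    omega
  obtain ⟨C, hC⟩ := OddSectorRate.oddSpecies_sum_abs_autocorr_le_uniform r (permSpecies (Equiv.swap 0 k) A)
    (permSpecies_odd k A hodd) hR3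
  refine ⟨C, fun β hβ S => le_of_eq_of_le (sum_congr rfl fun n _ => ?_) (hC β hβ S)⟩
  rw [covariance_axis_eq_latticeConnectedCorr_perm]

end AxisOddSummable

/-- **Registered sub-goal `stub_axisOddSpeciesSummable`** of item stmt-QuantumFields-9442, line `purity-rate-split`
(signature verbatim, fully qualified) — **spatial lattice Vafa–Witten**: for every compact `G`, every lattice
representation `r`, every axis `k : Fin 4` and every gauge-invariant local observable `A` odd under the axis reflection
`θ_k = configPermZd (swap 0 k) ∘ cfgReflect ∘ configPermZd (swap 0 k)`, the connected autocorrelation of `A` along `e_k`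
is `ℓ¹`-summable on the odd tori `2S+1`, uniformly in `S` and in `β ≥ 0`. [folklore] -/
theorem stub_axisOddSpeciesSummable : ∀ (G : Type) [Group G] [TopologicalSpace G] [IsTopologicalGroup G] [CompactSpace G] [MeasurableSpace G] [BorelSpace G] (r : Literature.MathematicalPhysics.QuantumFieldTheory.LatticeRep G) (k : Fin 4) (A : Literature.MathematicalPhysics.QuantumFieldTheory.YMSpecies G), (∀ V, A.F (Literature.MathematicalPhysics.QuantumFieldTheory.configPermZd (Equiv.swap 0 k) (Literature.MathematicalPhysics.QuantumFieldTheory.cfgReflect (Literature.MathematicalPhysics.QuantumFieldTheory.configPermZd (Equiv.swap 0 k) V))) = -A.F V) → ∃ C : ℝ, ∀ β : ℝ, 0 ≤ β → ∀ S : ℕ, ∑ n ∈ Finset.range (2 * S + 1), |ProbabilityTheory.covariance (fun U => A.F (Literature.MathematicalPhysics.QuantumLattice.torusLift (2 * S + 1) U)) (fun U => A.F (Literature.MathematicalPhysics.QuantumLattice.configShift (-(Pi.single k (n : ℤ))) (Literature.MathematicalPhysics.QuantumLattice.torusLift (2 * S + 1) U))) (Literature.MathematicalPhysics.QuantumFieldTheory.wilsonMeasure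 (d := 4) (L := 2 * S + 1) r.ρ β)| ≤ C :=
  fun _G _ _ _ _ _ _ r k A hodd => AxisOddSummable.axisOddSpecies_sum_abs_cov_le_uniform r k A hodd

end Summit.QuantumFields.YangMills.Theorems.FiniteSusceptibilityWeakCoupling

end
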